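import Summits.RiemannHypothesis.RiemannHypothesis.Theorems.DBNDbnLowAllTAxisBarrier
import Literature.NumberTheory.LFunctions.RodgersTaoZeroContinuity
import Mathlib.Analysis.Complex.RemovableSingularity
import Mathlib.Analysis.Complex.AbsMax
import Mathlib.Analysis.Complex.Liouville
import HarnessLib

/-!
# RiemannHypothesis / DBN — the near-axis slab of the P2 axis barrier is a REAL-AXIS
# no-coalescence margin (crux `DBN.DbnLowAllT`, stmt-RiemannHypothesis-0281)

LINE 1 — LABEL: the slab lemmas (`norm_sub_taylor_two_le`, `norm_le_of_zero_near_real`,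
`deBruijnH_ne_zero_of_margin`, `axisBarrier_of_top_of_margin`) are **RH-FREE** (generic complex
analysis: a second-order Schwarz/Taylor bound for an entire function bounded on a disc, applied to
`H_t = Literature.NumberTheory.LFunctions.deBruijnH t`, which is real together with `H_t'` on `ℝ`);
the reduction `dbnLowAllT_of_top_of_margin` is **CONDITIONAL** on the route's computational named
facts F1 `platt_trudgian_numerical_rh` and `platt_trudgian` (= F1 + F3 `Polymath15.table1_row2`)
and on certificate-shaped hypotheses that have NOT been computed.  The crux `DBN.DbnLowAllT` stays
OPEN.  bears_on: N-P (LADDER-RH §1, COLUMN 3 DBN, target P2).  WHAT THIS IS NOT: not a proof of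
P2, not a certificate, not evidence about RH — it re-expresses the near-axis part of P2's residual
(file `DBNDbnLowAllTAxisBarrier.lean`, p423818) as the C3 residual inequality
`0 < ‖H_t(x)‖² + ‖H_t'(x)‖²` (`DbnTheory.noCoalescence_iff_norm_sq_pos`) WITH MARGIN on ONE unit
interval; nothing here bears on the truth of RH.

## Content

* `norm_sub_taylor_two_le` (RH-FREE, generic): if `f` is entire and `‖f‖ ≤ M` on the closed disc
  `D̄(c, R)`, `R > 0`, then `‖f(w) − f(c) − f'(c)(w − c)‖ ≤ (3M/R²)‖w − c‖²` on `D̄(c, R)` — two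
  removable singularities (`dslope`) and the maximum modulus principle, with Cauchy's estimate
  `‖f'(c)‖ ≤ M/R` for the first-order term.
* `norm_le_of_zero_near_real` (RH-FREE, generic): if moreover `c = x ∈ ℝ`, `f(x)` and `f'(x)` are
  real, and `f(x + iy) = 0` with `|y| ≤ R`, then `‖f(x)‖ ≤ (3M/R²)y²` and `|y|‖f'(x)‖ ≤ (3M/R²)y²`
  (real and imaginary parts of `f(x) + iy f'(x)`).
* `deBruijnH_ne_zero_of_margin` (RH-FREE): for `H_t` (real with real derivative on `ℝ`,
  `deBruijnH_ofReal_im`, `deriv_deBruijnH_ofReal_im`): if `‖H_t‖ ≤ M` on the `R`-discs about the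
  points of `[a, b]` and at every `x ∈ [a, b]` either `‖H_t(x)‖ > (3M/R²)y₁²` or
  `‖H_t'(x)‖ > (3M/R²)y₁` (a NO-COALESCENCE MARGIN), then `H_t(x + iy) ≠ 0` for `x ∈ [a, b]`,
  `0 < y ≤ y₁` (`y₁ ≤ R`).
* `axisBarrier_of_top_of_margin` (RH-FREE): the axis-inclusive barrier of
  `DBNDbnLowAllTAxisBarrier.lean` on `[X, X+1] × (0, 1] × [0, T]` from (a) the TOP rectangle
  `[X, X+1] × [y₁, 1]` zero-free for `t ∈ [0, T]` — literally the hypothesis `hiii` of the tree's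
  `deBruijnNewmanConst_le_of_rectangles` (`DeBruijnNewmanBoundOfCertificates.lean`, winding
  certificates of Polymath 15 §8) with floor `y₁` — and (b) the sup bound + margin of
  `deBruijnH_ne_zero_of_margin` on `[X, X+1]`, `t ∈ [0, T]`.
* `dbnLowAllT_of_top_of_margin` (CONDITIONAL F1 + `platt_trudgian`): `DBN.DbnLowAllT` from (a)+(b)
  at any `X ∈ [6·10¹², 6 000 350 665 599]`, `T = 1/5`.

RESIDUAL OF RECORD FOR P2, refined (three interval-arithmetic verifications on a `t`-cover of
`[0, 1/5]`, none run): (a) winding certificates for `[X, X+1] × [y₁, 1]`; (b1) a sup bound `M` for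
`‖H_t‖` on the `R`-neighbourhood of `[X, X+1]`; (b2) the real-axis margin
`max(‖H_t(x)‖/y₁², ‖H_t'(x)‖/y₁) > 3M/R²` on `[X, X+1]`.

`--supports stmt-RiemannHypothesis-0281`; closes nothing.  Theorems only.

References (context): D. H. J. Polymath, Res. Math. Sci. 6 (2019) 31 = arXiv:1904.12438, §8;
the Schwarz-type bound is folklore (e.g. J. B. Conway, *Functions of One Complex Variable I*,
VI.2).
-/

noncomputable section

-- D-0017: `Summit.<S>.<S>.…` is the designed namespace of a single-problem summit.
set_option linter.dupNamespace false

namespace Summit.RiemannHypothesis.RiemannHypothesis.Theorems.DbnTheory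

open Literature.NumberTheory.LFunctions
open Summit.RiemannHypothesis.RiemannHypothesis.Theses
open Complex Set Metric Topology Filter

/-! ## A second-order Schwarz bound (RH-FREE, generic) -/

/-- **Second-order Taylor remainder by the maximum modulus principle.**  If `f : ℂ → ℂ` is entire
and `‖f w‖ ≤ M` on the closed disc `D̄(c, R)` (`R > 0`), then for every `w ∈ D̄(c, R)`,
`‖f(w) − f(c) − f'(c)(w − c)‖ ≤ (3M/R²)·‖w − c‖²`.  (The function
`g = f − f(c) − f'(c)(· − c)` is bounded by `3M` on the circle, Cauchy's estimate giving
`‖f'(c)‖ ≤ M/R`; dividing twice by `w − c` (removable singularities, `dslope`) and applying the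
maximum modulus principle each time gives `‖g(w)/(w − c)²‖ ≤ 3M/R²`.) [folklore] -/
theorem norm_sub_taylor_two_le {f : ℂ → ℂ} (hf : Differentiable ℂ f) {c : ℂ} {R M : ℝ}
    (hR : 0 < R) (hM : ∀ w ∈ closedBall c R, ‖f w‖ ≤ M) {w : ℂ} (hw : w ∈ closedBall c R) :
    ‖f w - f c - deriv f c * (w - c)‖ ≤ 3 * M / R ^ 2 * ‖w - c‖ ^ 2 := by
  have hM0 : 0 ≤ M := (norm_nonneg _).trans (hM c (mem_closedBall_self hR.le))
  -- Cauchy's estimate for `f'(c)`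
  have hd1 : ‖deriv f c‖ ≤ M / R :=
    Complex.norm_deriv_le_of_forall_mem_sphere_norm_le hR hf.diffContOnCl
      fun z hz ↦ hM z (sphere_subset_closedBall hz)
  -- the second-order remainder `g`
  set g : ℂ → ℂ := fun w ↦ f w - f c - deriv f c * (w - c) with hg
  have hgd : Differentiable ℂ g := by
    simp only [hg]; fun_prop
  have hgc : g c = 0 := by simp [hg]
  have hg' : deriv g c = 0 := by
    have h : HasDerivAt g (deriv f c - deriv f c * 1) c := by
      have h1 : HasDerivAt f (deriv f c) c := (hf c).hasDerivAt
      have h2 : HasDerivAt (fun w : ℂ ↦ deriv f c * (w - c)) (deriv f c * 1) c :=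
        ((hasDerivAt_id c).sub_const c).const_mul (deriv f c)
      rw [hg]
      exact (h1.sub_const (f c)).fun_sub h2
    rw [h.deriv]; ring
  -- `g` on the circle
  have hgS : ∀ z ∈ sphere c R, ‖g z‖ ≤ 3 * M := by
    intro z hz
    have hzc : ‖z - c‖ = R := by rw [← dist_eq_norm]; exact hz
    calc ‖g z‖ ≤ ‖f z - f c‖ + ‖deriv f c * (z - c)‖ := norm_sub_le _ _
      _ ≤ (‖f z‖ + ‖f c‖) + ‖deriv f c‖ * ‖z - c‖ := by
          gcongr
          · exact norm_sub_le _ _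
          · exact (norm_mul _ _).le
      _ ≤ (M + M) + M / R * R := by
          gcongr
          · exact hM z (sphere_subset_closedBall hz)
          · exact hM c (mem_closedBall_self hR.le)
          · rw [hzc]
      _ = 3 * M := by field_simp; ring
  -- first division: `φ = g/(· − c)`
  set φ : ℂ → ℂ := dslope g c with hφ
  have hφd : Differentiable ℂ φ :=
    differentiableOn_univ.1 ((Complex.differentiableOn_dslope univ_mem).2 hgd.differentiableOn)
  have hφS : ∀ z ∈ sphere c R, ‖φ z‖ ≤ 3 * M / R := by
    intro z hz
    have hzc' : z ≠ c := by
      intro h; rw [h, mem_sphere, dist_self] at hz; exact hR.ne' hz.symm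
    have hzc : ‖z - c‖ = R := by rw [← dist_eq_norm]; exact hz
    have : φ z = (z - c)⁻¹ * g z := by
      rw [hφ, dslope_of_ne _ hzc', slope_def_field, hgc, sub_zero, div_eq_inv_mul]
    rw [this, norm_mul, norm_inv, hzc, inv_mul_eq_div]
    exact div_le_div_of_nonneg_right (hgS z hz) hR.le
  have hφB : ∀ z ∈ closedBall c R, ‖φ z‖ ≤ 3 * M / R := fun z hz ↦
    Complex.norm_le_of_forall_mem_frontier_norm_le isBounded_ball hφd.diffContOnCl
      (by rw [frontier_ball c hR.ne']; exact hφS) (by rw [closure_ball c hR.ne']; exact hz)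
  have hφc : φ c = 0 := by rw [hφ, dslope_same, hg']
  -- second division: `ψ = φ/(· − c)`
  set ψ : ℂ → ℂ := dslope φ c with hψ
  have hψd : Differentiable ℂ ψ :=
    differentiableOn_univ.1 ((Complex.differentiableOn_dslope univ_mem).2 hφd.differentiableOn)
  have hψS : ∀ z ∈ sphere c R, ‖ψ z‖ ≤ 3 * M / R ^ 2 := by
    intro z hz
    have hzc' : z ≠ c := by
      intro h; rw [h, mem_sphere, dist_self] at hz; exact hR.ne' hz.symm
    have hzc : ‖z - c‖ = R := by rw [← dist_eq_norm]; exact hz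
    have : ψ z = (z - c)⁻¹ * φ z := by
      rw [hψ, dslope_of_ne _ hzc', slope_def_field, hφc, sub_zero, div_eq_inv_mul]
    rw [this, norm_mul, norm_inv, hzc, inv_mul_eq_div, pow_two, ← div_div]
    exact div_le_div_of_nonneg_right (hφS z hz) hR.le
  have hψB : ∀ z ∈ closedBall c R, ‖ψ z‖ ≤ 3 * M / R ^ 2 := fun z hz ↦
    Complex.norm_le_of_forall_mem_frontier_norm_le isBounded_ball hψd.diffContOnCl
      (by rw [frontier_ball c hR.ne']; exact hψS) (by rw [closure_ball c hR.ne']; exact hz)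
  -- reassemble: `g w = (w − c)² ψ w`
  have h1 : (w - c) * φ w = g w := by
    have := sub_smul_dslope g c w
    rw [smul_eq_mul, hgc, sub_zero] at this
    exact this
  have h2 : (w - c) * ψ w = φ w := by
    have := sub_smul_dslope φ c w
    rw [smul_eq_mul, hφc, sub_zero] at this
    exact this
  have hgw : g w = (w - c) ^ 2 * ψ w := by rw [← h1, ← h2]; ring
  have : f w - f c - deriv f c * (w - c) = g w := rfl
  rw [this, hgw, norm_mul, norm_pow, mul_comm]
  exact mul_le_mul_of_nonneg_right (hψB w hw) (by positivity)

/-- **A zero near a real point forces `f` AND `f'` to be small there** (RH-FREE, generic).  Let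
`f` be entire with `‖f‖ ≤ M` on `D̄(x, R)`, `x ∈ ℝ`, `R > 0`, and suppose `f(x)` and `f'(x)` are
real.  If `f(x + iy) = 0` with `|y| ≤ R`, then `‖f(x)‖ ≤ (3M/R²)y²` and `|y|·‖f'(x)‖ ≤ (3M/R²)y²`
— the real and imaginary parts of `f(x) + iy·f'(x) = −(second-order remainder)`. [folklore] -/
theorem norm_le_of_zero_near_real {f : ℂ → ℂ} (hf : Differentiable ℂ f) {x R M y : ℝ}
    (hR : 0 < R) (hM : ∀ w ∈ closedBall (x : ℂ) R, ‖f w‖ ≤ M) (hfx : (f x).im = 0)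
    (hdx : (deriv f x).im = 0) (hyR : |y| ≤ R) (hz : f (x + y * I) = 0) :
    ‖f x‖ ≤ 3 * M / R ^ 2 * y ^ 2 ∧ |y| * ‖deriv f x‖ ≤ 3 * M / R ^ 2 * y ^ 2 := by
  have hw : (x : ℂ) + y * I ∈ closedBall (x : ℂ) R := by
    rw [mem_closedBall, dist_eq_norm, add_sub_cancel_left, norm_mul, Complex.norm_I, mul_one,
      Complex.norm_real, Real.norm_eq_abs]
    exact hyR
  have key := norm_sub_taylor_two_le hf hR hM hw
  rw [hz, zero_sub, add_sub_cancel_left, norm_mul, Complex.norm_I, mul_one, Complex.norm_real,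
    Real.norm_eq_abs, sq_abs] at key
  -- the vector `u = −f(x) − f'(x)·(iy)` has real part `−Re f(x)` and imaginary part `−y·Re f'(x)`
  set u : ℂ := -f x - deriv f x * (y * I) with hu
  have hure : u.re = -(f x).re := by
    simp [hu, Complex.mul_re, hdx]
  have huim : u.im = -((deriv f x).re * y) := by
    simp [hu, Complex.mul_im, hdx, hfx]
  have hn1 : ‖f (x : ℂ)‖ ≤ ‖u‖ := by
    have h := Complex.abs_re_le_norm u
    rw [hure, abs_neg, Complex.abs_re_eq_norm.2 hfx] at h
    exact h
  have hn2 : |y| * ‖deriv f x‖ ≤ ‖u‖ := by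
    have h := Complex.abs_im_le_norm u
    rw [huim, abs_neg, abs_mul, Complex.abs_re_eq_norm.2 hdx, mul_comm] at h
    exact h
  exact ⟨hn1.trans key, hn2.trans key⟩

/-! ## The near-axis slab for `H_t` (RH-FREE) -/

/-- **RH-FREE — near-axis slab from a real-axis no-coalescence margin.**  Fix `t`, an interval
`[a, b]`, a radius `R > 0`, a height `y₁ ≤ R`, and a bound `M` with `‖H_t(w)‖ ≤ M` for all
`w` within `R` of some point of `[a, b]`.  If at every `x ∈ [a, b]` either
`‖H_t(x)‖ > (3M/R²)·y₁²` or `‖H_t'(x)‖ > (3M/R²)·y₁` (the inequality `0 < ‖H_t(x)‖² + ‖H_t'(x)‖²`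
of `DbnTheory.noCoalescence_iff_norm_sq_pos`, with margin), then `H_t` has no zero `x + iy` with
`x ∈ [a, b]`, `0 < y ≤ y₁`.  (`H_t` is entire, `differentiable_deBruijnH_holds`, and real with real
derivative on `ℝ`, `deBruijnH_ofReal_im`, `deriv_deBruijnH_ofReal_im`.) [folklore] -/
theorem deBruijnH_ne_zero_of_margin {t a b y₁ R M : ℝ} (hR : 0 < R) (hy₁R : y₁ ≤ R)
    (hM : ∀ x ∈ Icc a b, ∀ w ∈ closedBall (x : ℂ) R, ‖deBruijnH t w‖ ≤ M)
    (hmargin : ∀ x ∈ Icc a b, 3 * M / R ^ 2 * y₁ ^ 2 < ‖deBruijnH t x‖ ∨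
      3 * M / R ^ 2 * y₁ < ‖deriv (deBruijnH t) x‖)
    {x y : ℝ} (hx : x ∈ Icc a b) (hy0 : 0 < y) (hy1 : y ≤ y₁) : deBruijnH t (x + y * I) ≠ 0 := by
  intro hzero
  have hM0 : 0 ≤ M := (norm_nonneg _).trans (hM x hx x (mem_closedBall_self hR.le))
  have hC0 : 0 ≤ 3 * M / R ^ 2 := by positivity
  have hyR : |y| ≤ R := by rw [abs_of_pos hy0]; exact hy1.trans hy₁R
  obtain ⟨h1, h2⟩ := norm_le_of_zero_near_real (differentiable_deBruijnH_holds t) hR (hM x hx)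
    (deBruijnH_ofReal_im t x) (deriv_deBruijnH_ofReal_im t x) hyR hzero
  rcases hmargin x hx with hm | hm
  · have : 3 * M / R ^ 2 * y ^ 2 ≤ 3 * M / R ^ 2 * y₁ ^ 2 :=
      mul_le_mul_of_nonneg_left (pow_le_pow_left₀ hy0.le hy1 2) hC0
    linarith
  · rw [abs_of_pos hy0] at h2
    have h3 : ‖deriv (deBruijnH t) x‖ ≤ 3 * M / R ^ 2 * y := by
      have : y * ‖deriv (deBruijnH t) ↑x‖ ≤ y * (3 * M / R ^ 2 * y) := by
        calc y * ‖deriv (deBruijnH t) ↑x‖ ≤ 3 * M / R ^ 2 * y ^ 2 := h2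
          _ = y * (3 * M / R ^ 2 * y) := by ring
      exact le_of_mul_le_mul_left this hy0
    have : 3 * M / R ^ 2 * y ≤ 3 * M / R ^ 2 * y₁ := mul_le_mul_of_nonneg_left hy1 hC0
    linarith

/-- **RH-FREE — the axis-inclusive barrier from a TOP rectangle and a near-axis MARGIN.**  On the
strip `[X, X+1]`, times `t ∈ [0, T]`: if (a) `H_t(x + iy) ≠ 0` for `y₁ ≤ y ≤ 1` (the rectangle
hypothesis `hiii` of `deBruijnNewmanConst_le_of_rectangles`, floor `y₁`; certified in print by
winding numbers, Polymath 15 §8), and (b) `‖H_t‖ ≤ M` on the `R`-neighbourhood of `[X, X+1]` with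
the margin `‖H_t(x)‖ > (3M/R²)y₁² ∨ ‖H_t'(x)‖ > (3M/R²)y₁` at every `x ∈ [X, X+1]`
(`0 < y₁ ≤ R`), then `H_t(x + iy) ≠ 0` for all `X ≤ x ≤ X+1`, `0 < y ≤ 1`, `t ∈ [0, T]` — the
hypothesis `hbar` of `DbnTheory.im_eq_zero_of_axisBarrier` / `dbnLowAllT_of_axisBarrier`.
[cite: Polymath2019, §8] -/
theorem axisBarrier_of_top_of_margin {X T y₁ R M : ℝ} (hR : 0 < R) (hy₁R : y₁ ≤ R)
    (htop : ∀ t x y : ℝ, 0 ≤ t → t ≤ T → X ≤ x → x ≤ X + 1 → y₁ ≤ y → y ≤ 1 →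
      deBruijnH t (x + y * I) ≠ 0)
    (hM : ∀ t ∈ Icc 0 T, ∀ x ∈ Icc X (X + 1), ∀ w ∈ closedBall (x : ℂ) R, ‖deBruijnH t w‖ ≤ M)
    (hmargin : ∀ t ∈ Icc 0 T, ∀ x ∈ Icc X (X + 1), 3 * M / R ^ 2 * y₁ ^ 2 < ‖deBruijnH t x‖ ∨
      3 * M / R ^ 2 * y₁ < ‖deriv (deBruijnH t) x‖) :
    ∀ t x y : ℝ, 0 ≤ t → t ≤ T → X ≤ x → x ≤ X + 1 → 0 < y → y ≤ 1 →
      deBruijnH t (x + y * I) ≠ 0 := by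
  intro t x y ht0 htT hXx hx1 hy0 hy1
  rcases le_or_gt y₁ y with hle | hlt
  · exact htop t x y ht0 htT hXx hx1 hle hy1
  · exact deBruijnH_ne_zero_of_margin hR hy₁R (hM t ⟨ht0, htT⟩) (hmargin t ⟨ht0, htT⟩) ⟨hXx, hx1⟩
      hy0 hlt.le

/-! ## P2 from a top rectangle and a near-axis margin (CONDITIONAL on F1 and `Λ ≤ 1/5`) -/

/-- **CONDITIONAL(F1, `platt_trudgian`) — `DBN.DbnLowAllT` from a winding-certifiable TOP rectangle
and a real-axis NO-COALESCENCE MARGIN.**  Assume F1 (`platt_trudgian_numerical_rh`) and `Λ ≤ 1/5`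
(`platt_trudgian`).  Let `6·10¹² ≤ X ≤ 6 000 350 665 599`, `0 < R`, `y₁ ≤ R`.  If for all
`t ∈ [0, 1/5]`: (a) `H_t(x + iy) ≠ 0` for `X ≤ x ≤ X+1`, `y₁ ≤ y ≤ 1`; (b1) `‖H_t‖ ≤ M` on the
`R`-neighbourhood of `[X, X+1]`; (b2) at every `x ∈ [X, X+1]`, `‖H_t(x)‖ > (3M/R²)y₁²` or
`‖H_t'(x)‖ > (3M/R²)y₁` — three interval-arithmetic verifications, none run — then every zero of
every `H_t`, `t > 0`, with `|Re z| < 6·10¹²` is real (`DBN.DbnLowAllT`, stmt-RiemannHypothesis-0281).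
[cite: Polymath2019, Prop. 3.3, §8] [cite: PlattTrudgianBLMS2021, Thm. 1, Cor. 2] -/
theorem dbnLowAllT_of_top_of_margin (h₁ : platt_trudgian_numerical_rh) (h₂ : platt_trudgian)
    {X y₁ R M : ℝ} (hX : 6000000000000 ≤ X) (hX' : X ≤ 6000350665599) (hR : 0 < R)
    (hy₁R : y₁ ≤ R)
    (htop : ∀ t x y : ℝ, 0 ≤ t → t ≤ 1 / 5 → X ≤ x → x ≤ X + 1 → y₁ ≤ y → y ≤ 1 →
      deBruijnH t (x + y * I) ≠ 0)
    (hM : ∀ t ∈ Icc (0 : ℝ) (1 / 5), ∀ x ∈ Icc X (X + 1), ∀ w ∈ closedBall (x : ℂ) R,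
      ‖deBruijnH t w‖ ≤ M)
    (hmargin : ∀ t ∈ Icc (0 : ℝ) (1 / 5), ∀ x ∈ Icc X (X + 1),
      3 * M / R ^ 2 * y₁ ^ 2 < ‖deBruijnH t x‖ ∨ 3 * M / R ^ 2 * y₁ < ‖deriv (deBruijnH t) x‖) :
    DBN.DbnLowAllT :=
  dbnLowAllT_of_axisBarrier h₁ h₂ hX hX' (axisBarrier_of_top_of_margin hR hy₁R htop hM hmargin)

end Summit.RiemannHypothesis.RiemannHypothesis.Theorems.DbnTheory

end
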